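import Literature.Geometry.Lorentzian.DivergenceTheorem
import Literature.Geometry.Lorentzian.GeodesicSpeed
import Literature.Geometry.Lorentzian.CoordinateFrames
import Literature.Geometry.Lorentzian.DalembertianCompose
import Literature.Geometry.Lorentzian.EnergyCurrents
import Literature.Geometry.Riemannian.RicciFlowScalarCurvatureProofs
import HarnessLib

/-!
# The second derivative of a function along a curve, level curves, and the geodesic curvature
# of a level curve of a function on a surface

For a pseudo-Riemannian manifold `(M, g)` with its Levi-Civita connection, a `C²` function `f`
and a twice differentiable curve `γ`:

* `hasDerivAt_mvfderiv_velocity` — **`(f ∘ γ)'' = Hess f(γ', γ') + df(γ'')`**: the function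
  `t ↦ df_{γ t}(γ' t)` has derivative `Hess f(γ', γ')(t₀) + df(D_t γ')(t₀)` at `t₀`
  (O'Neill 1983, Ch. 3, Def. 3.48–Lemma 3.49 with Prop. 3.18 (3):
  `H^f(γ', γ') = ⟨D_{γ'} grad f, γ'⟩`
  and `(d/dt)⟨grad f, γ'⟩ = ⟨D_{γ'} grad f, γ'⟩ + ⟨grad f, γ''⟩`);
* `mvfderiv_velocity_eq_zero_of_level`, `mvfderiv_covariantDerivAlong_velocity_of_level`,
  `val_covariantDerivAlong_velocity_grad_of_level` — along a **level curve** (`f ∘ γ` constant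
  near `t₀`): `df(γ') = 0` and **`df(γ'') = ⟨γ'', grad f⟩ = −Hess f(γ', γ')`**;
* `mvfderiv_gradSq_apply` — **`d|∇f|²(v) = 2 Hess f(v, grad f)`** (metric compatibility);
* on a surface (`dim = 2`, `g` positive definite at the point):
  `dalembertian_eq_hessian_add_of_orthonormal` (`Δf = Hess f(T,T) + Hess f(N,N)` in an
  orthonormal pair) and the **geodesic curvature of a level curve**,
  `val_covariantDerivAlong_velocity_unitNormal_of_level`: for a unit-speed level curve `γ` of `f`
  through a regular point and the unit normal `N = grad f/|grad f|`,

    `⟨γ'', N⟩ = ( g⁻¹(d|∇f|², df) / (2|∇f|²) − Δf ) / |∇f|`,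

  i.e. the geodesic curvature of the level curve `{f = f(γ t₀)}` with respect to the normal
  pointing **into** `{f ≤ f(γ t₀)}` is `k = (Δf − Hess f(N,N)) / |∇f|`
  (`Hess f(N, N) = g⁻¹(d|∇f|², df) / (2|∇f|²)`), the classical formula
  `k = div(∇f/|∇f|)` for level curves (the signed curvature `κ_N = ⟨D_t γ', N⟩` of Lee 2018,
  Ch. 9, p. 273, computed for a level curve);
* `flux_integrand_comp_eq` — for a cut-off `ψ = η ∘ f` the integrand of the curvature flux
  formula (`SurfaceCurvatureFlux[CompactSupport].lean`,
  `∫ ψ S dμ = −∫ (g⁻¹(d|∇f|², dψ) − 2 Δf g⁻¹(df, dψ)) / |∇f|² dμ`) is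
  `2 η'(f) ( g⁻¹(d|∇f|², df)/(2|∇f|²) − Δf ) = 2 η'(f) |∇f| ⟨γ'', N⟩ = −2 η'(f) |∇f| k`:
  the Gauss–Bonnet boundary term `∫_{∂D} k ds` of a sublevel domain `D = {f ≤ σ}`, smeared over
  the levels in `supp η'` (by the coarea formula, not used here).

This is the intrinsic form of Schoen–Yau's computation (2.27) (Comm. Math. Phys. 65 (1979), §2,
p. 58: the geodesic curvature `k` of `∂D_σ = S ∩ {r' = σ}` is obtained by differentiating
`⟨e₁, Dr'⟩ = 0` along the unit tangent `e₁`, `k⟨e₂, Dr'⟩ = h₁₁⟨ν, Dr'⟩ − Hess_N r'(e₁, e₁)`; the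
ambient Hessian splits into the intrinsic one and the second fundamental form by
`HypersurfaceHessian.hessian_comp_apply`). Everything is proved; no definitions, no named facts.

## References

* B. O'Neill, *Semi-Riemannian geometry with applications to relativity*, Academic Press 1983,
  Ch. 3, Prop. 3.18, Def. 3.48–3.50, Lemma 3.49. [ONeill1983]
* J. M. Lee, *Introduction to Riemannian Manifolds*, 2nd ed., Springer 2018, Ch. 8, p. 232
  (geodesic curvature), Ch. 9, p. 273 (signed curvature `κ_N = ⟨D_t γ', N⟩_g` with respect to the
  inward normal) and Thm. 9.3 (the Gauss–Bonnet formula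
  `∫_Ω K dA + ∫_γ κ_N ds + Σ εᵢ = 2π`). [Lee2018]
* R. Schoen, S.-T. Yau, *On the proof of the positive mass conjecture in general relativity*,
  Comm. Math. Phys. 65 (1979) 45–76, §2, p. 58, (2.26)–(2.27). [SchoenYauPMT1979]
-/

noncomputable section

open Bundle Set Function Filter Manifold Module FiberBundle
open scoped Manifold ContDiff Topology

namespace Literature.Geometry.Lorentzian

namespace PseudoRiemannianMetric

variable {E : Type*} [NormedAddCommGroup E] [NormedSpace ℝ E] {H : Type*} [TopologicalSpace H]
  {I : ModelWithCorners ℝ E H} {M : Type*} [TopologicalSpace M] [ChartedSpace H M]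
  [IsManifold I ∞ M] [FiniteDimensional ℝ E] [CompleteSpace E] [I.Boundaryless]
  (g : PseudoRiemannianMetric I ∞ E (TangentSpace I : M → Type _)) [g.HasLeviCivita]

/-! ### The second derivative of a function along a curve -/

/-- **`(f ∘ γ)'' = Hess f(γ', γ') + df(γ'')`.** For `f` of class `C²` at `γ t₀` and a curve `γ`
whose tangent lift `t ↦ (γ t, γ' t)` is differentiable at `t₀`, the function `t ↦ df_{γ t}(γ' t)`
(which is `(f ∘ γ)'` wherever `f ∘ γ` is differentiable) has derivative
`Hess f(γ' t₀, γ' t₀) + df_{γ t₀}(D_t γ'(t₀))` at `t₀`. Proof: `df(γ') = ⟨grad f ∘ γ, γ'⟩`;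
differentiate with the product rule along `γ` (`hasDerivAt_val_apply_along`, metric
compatibility), `D_t(grad f ∘ γ) = D_{γ'} grad f` (`covariantDerivAlong_comp`) and
`⟨D_{γ'} grad f, γ'⟩ = Hess f(γ', γ')` (`val_leviCivita_sharp_mvfderiv`). O'Neill 1983, Ch. 3,
Lemma 3.49 and Prop. 3.18 (3). [cite: ONeill1983, Ch. 3, Lemma 3.49] -/
theorem hasDerivAt_mvfderiv_velocity {f : M → ℝ} {γ : ℝ → M} {t₀ : ℝ}
    (hf : CMDiffAt 2 f (γ t₀))
    (hγ2 : MDifferentiableAt 𝓘(ℝ, ℝ) I.tangent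
      (fun t ↦ (TotalSpace.mk' E (γ t) (velocity I γ t) : TangentBundle I M)) t₀) :
    HasDerivAt (fun t ↦ mvfderiv I f (γ t) (velocity I γ t))
      (g.hessian f (γ t₀) (velocity I γ t₀) (velocity I γ t₀) +
        mvfderiv I f (γ t₀) (covariantDerivAlong g.leviCivita γ (fun t ↦ velocity I γ t) t₀))
      t₀ := by
  set G : Π y : M, TangentSpace I y := fun y ↦
    (g.sharp y (mvfderiv I f y).toLinearMap : TangentSpace I y) with hG
  have hGd : MDiffAt (T% G) (γ t₀) := g.mdifferentiableAt_sharp_mvfderiv hf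
  have hγ : MDifferentiableAt 𝓘(ℝ, ℝ) I γ t₀ := mdifferentiableAt_of_mdifferentiableAt_lift hγ2
  have hGlift : MDifferentiableAt 𝓘(ℝ, ℝ) I.tangent
      (fun t ↦ (TotalSpace.mk' E (γ t) (G (γ t)) : TangentBundle I M)) t₀ := hGd.comp t₀ hγ
  have hLC := isLeviCivita_leviCivita_holds (g := g)
  have hd := g.hasDerivAt_val_apply_along hLC.2 (γ := γ) (V := fun t ↦ G (γ t))
    (W := fun t ↦ velocity I γ t) (t₀ := t₀) hGlift hγ2
  have hφ : (fun t ↦ g.val (γ t) (G (γ t)) (velocity I γ t)) =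
      fun t ↦ mvfderiv I f (γ t) (velocity I γ t) := by
    funext t
    simp only [hG, val_sharp_apply, ContinuousLinearMap.coe_coe]
  rw [hφ] at hd
  have h1 : covariantDerivAlong g.leviCivita γ (fun t ↦ G (γ t)) t₀ =
      g.leviCivita G (γ t₀) (velocity I γ t₀) :=
    covariantDerivAlong_comp_holds g.leviCivita hγ hGd
  have h2 : g.val (γ t₀) (g.leviCivita G (γ t₀) (velocity I γ t₀)) (velocity I γ t₀) =
      g.hessian f (γ t₀) (velocity I γ t₀) (velocity I γ t₀) :=
    g.val_leviCivita_sharp_mvfderiv hf _ _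
  have h3 : g.val (γ t₀) (G (γ t₀))
      (covariantDerivAlong g.leviCivita γ (fun t ↦ velocity I γ t) t₀) =
      mvfderiv I f (γ t₀) (covariantDerivAlong g.leviCivita γ (fun t ↦ velocity I γ t) t₀) := by
    simp only [hG, val_sharp_apply, ContinuousLinearMap.coe_coe]
  rw [h1, h2, h3] at hd
  exact hd

/-! ### Level curves -/

omit [FiniteDimensional ℝ E] [CompleteSpace E] [I.Boundaryless] in
/-- **A level curve is tangent to the level set**: if `f ∘ γ` is constant near `t₀`, `f` is `C²`
at `γ t₀` and `γ` is differentiable near `t₀`, then `df_{γ t}(γ' t) = 0` for `t` near `t₀`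
(chain rule and the vanishing of the derivative of a locally constant function). O'Neill 1983,
Ch. 1, Lemma 15 ff. (No metric is involved.) [cite: ONeill1983, Ch. 3, Lemma 3.49] -/
theorem _root_.Literature.Geometry.Lorentzian.eventually_mvfderiv_velocity_eq_zero_of_level
    {f : M → ℝ} {γ : ℝ → M} {t₀ : ℝ}
    (hf : CMDiffAt 2 f (γ t₀)) (hγ : ∀ᶠ t in 𝓝 t₀, MDifferentiableAt 𝓘(ℝ, ℝ) I γ t)
    (hγc : ContinuousAt γ t₀) (hlev : ∀ᶠ t in 𝓝 t₀, f (γ t) = f (γ t₀)) :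
    ∀ᶠ t in 𝓝 t₀, mvfderiv I f (γ t) (velocity I γ t) = 0 := by
  have hft₀ : ∀ᶠ y in 𝓝 (γ t₀), CMDiffAt 2 f y :=
    (contMDiffAt_iff_contMDiffAt_nhds (by decide)).1 hf
  have hfd : ∀ᶠ t in 𝓝 t₀, MDifferentiableAt I 𝓘(ℝ, ℝ) f (γ t) := by
    filter_upwards [hγc.eventually hft₀] with t ht
    exact ht.mdifferentiableAt two_ne_zero
  have hlev2 : ∀ᶠ t in 𝓝 t₀, ∀ᶠ s in 𝓝 t, f (γ s) = f (γ t₀) := eventually_eventually_nhds.2 hlev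
  filter_upwards [hfd, hγ, hlev2] with t hft hγt hlt
  have hchain : HasDerivAt (fun s ↦ f (γ s)) (mfderiv I 𝓘(ℝ, ℝ) f (γ t) (velocity I γ t)) t :=
    hasDerivAt_comp_curve hft hγt
  have hconst : HasDerivAt (fun s ↦ f (γ s)) 0 t :=
    (hasDerivAt_const t (f (γ t₀))).congr_of_eventuallyEq hlt
  exact hchain.unique hconst

omit [FiniteDimensional ℝ E] [CompleteSpace E] [I.Boundaryless] in
/-- **A level curve is tangent to the level set** (at the base time): `df_{γ t₀}(γ' t₀) = 0`.
(No metric is involved.) [cite: ONeill1983, Ch. 3, Lemma 3.49] -/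
theorem _root_.Literature.Geometry.Lorentzian.mvfderiv_velocity_eq_zero_of_level
    {f : M → ℝ} {γ : ℝ → M} {t₀ : ℝ}
    (hf : CMDiffAt 2 f (γ t₀)) (hγ : ∀ᶠ t in 𝓝 t₀, MDifferentiableAt 𝓘(ℝ, ℝ) I γ t)
    (hγc : ContinuousAt γ t₀) (hlev : ∀ᶠ t in 𝓝 t₀, f (γ t) = f (γ t₀)) :
    mvfderiv I f (γ t₀) (velocity I γ t₀) = 0 :=
  (eventually_mvfderiv_velocity_eq_zero_of_level hf hγ hγc hlev).self_of_nhds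

/-- **`df(γ'') = −Hess f(γ', γ')` along a level curve.** For `f` of class `C²` at `γ t₀`, `γ`
differentiable near `t₀` with tangent lift differentiable at `t₀`, and `f ∘ γ` constant near
`t₀`: `df_{γ t₀}(D_t γ'(t₀)) = −Hess f(γ' t₀, γ' t₀)` (differentiate `df(γ') ≡ 0`,
`hasDerivAt_mvfderiv_velocity`). This is the computation behind the geodesic curvature of a level
curve (O'Neill 1983, Ch. 3, Lemma 3.49; Schoen–Yau 1979, (2.27): differentiate `⟨e₁, Dr'⟩ = 0`
along `e₁`). [cite: ONeill1983, Ch. 3, Lemma 3.49] -/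
theorem mvfderiv_covariantDerivAlong_velocity_of_level {f : M → ℝ} {γ : ℝ → M} {t₀ : ℝ}
    (hf : CMDiffAt 2 f (γ t₀)) (hγ : ∀ᶠ t in 𝓝 t₀, MDifferentiableAt 𝓘(ℝ, ℝ) I γ t)
    (hγ2 : MDifferentiableAt 𝓘(ℝ, ℝ) I.tangent
      (fun t ↦ (TotalSpace.mk' E (γ t) (velocity I γ t) : TangentBundle I M)) t₀)
    (hlev : ∀ᶠ t in 𝓝 t₀, f (γ t) = f (γ t₀)) :
    mvfderiv I f (γ t₀) (covariantDerivAlong g.leviCivita γ (fun t ↦ velocity I γ t) t₀) =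
      -g.hessian f (γ t₀) (velocity I γ t₀) (velocity I γ t₀) := by
  have hA := g.hasDerivAt_mvfderiv_velocity hf hγ2
  have hγc : ContinuousAt γ t₀ := (mdifferentiableAt_of_mdifferentiableAt_lift hγ2).continuousAt
  have hzero := eventually_mvfderiv_velocity_eq_zero_of_level hf hγ hγc hlev
  have h0 : HasDerivAt (fun t ↦ mvfderiv I f (γ t) (velocity I γ t)) 0 t₀ :=
    (hasDerivAt_const t₀ (0 : ℝ)).congr_of_eventuallyEq hzero
  have := hA.unique h0
  linarith

/-- **`⟨γ'', grad f⟩ = −Hess f(γ', γ')` along a level curve** (the same identity with the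
gradient `grad f = ♯ df`, `⟨γ'', grad f⟩ = df(γ'')`). [cite: ONeill1983, Ch. 3, Lemma 3.49] -/
theorem val_covariantDerivAlong_velocity_grad_of_level {f : M → ℝ} {γ : ℝ → M} {t₀ : ℝ}
    (hf : CMDiffAt 2 f (γ t₀)) (hγ : ∀ᶠ t in 𝓝 t₀, MDifferentiableAt 𝓘(ℝ, ℝ) I γ t)
    (hγ2 : MDifferentiableAt 𝓘(ℝ, ℝ) I.tangent
      (fun t ↦ (TotalSpace.mk' E (γ t) (velocity I γ t) : TangentBundle I M)) t₀)
    (hlev : ∀ᶠ t in 𝓝 t₀, f (γ t) = f (γ t₀)) :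
    g.val (γ t₀) (covariantDerivAlong g.leviCivita γ (fun t ↦ velocity I γ t) t₀)
        (g.sharp (γ t₀) (mvfderiv I f (γ t₀)).toLinearMap) =
      -g.hessian f (γ t₀) (velocity I γ t₀) (velocity I γ t₀) := by
  rw [← g.mvfderiv_covariantDerivAlong_velocity_of_level hf hγ hγ2 hlev, g.symm (γ t₀),
    val_sharp_apply, ContinuousLinearMap.coe_coe]

/-! ### The differential of `|∇f|²` -/

/-- **`d|∇f|²(v) = 2 Hess f(v, grad f)`** for `f` of class `C²` at `x`: with `grad f = ♯ df`,
`|∇f|² = df(grad f) = (grad f) f`, so `v(|∇f|²) = Hess f(v, grad f) + df(D_v grad f)`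
(`hessian_apply`) and `df(D_v grad f) = ⟨grad f, D_v grad f⟩ = Hess f(v, grad f)`
(`val_leviCivita_sharp_mvfderiv`). O'Neill 1983, Ch. 3, Lemma 3.49 and Def. 3.50
(`H^f(X, Y) = ⟨D_X grad f, Y⟩`). [cite: ONeill1983, Ch. 3, Lemma 3.49] -/
theorem mvfderiv_gradSq_apply {f : M → ℝ} {x : M} (hf : CMDiffAt 2 f x) (v : TangentSpace I x) :
    mvfderiv I (g.gradSq f) x v =
      2 * g.hessian f x v (g.sharp x (mvfderiv I f x).toLinearMap) := by
  set G : Π y : M, TangentSpace I y := fun y ↦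
    (g.sharp y (mvfderiv I f y).toLinearMap : TangentSpace I y) with hG
  have hGd : MDiffAt (T% G) x := g.mdifferentiableAt_sharp_mvfderiv hf
  set X : Π y : M, TangentSpace I y := FiberBundle.extend E v with hX
  have hXd : MDiffAt (T% X) x := mdifferentiableAt_extend (I := I) E v
  have hXx : X x = v := extend_apply_self (F := E) v
  have hH : g.hessian f x (X x) (G x) = g.hessianAux f X G x :=
    hessian_apply_holds (g := g) hf hXd hGd
  have hgs : (fun y ↦ mvfderiv I f y (G y)) = g.gradSq f := by
    funext y
    rfl
  have h2 : mvfderiv I f x (g.leviCivita G x v) = g.hessian f x v (G x) := by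
    rw [← g.val_leviCivita_sharp_mvfderiv hf v (G x), g.symm x (g.leviCivita G x v) (G x)]
    simp only [hG, val_sharp_apply, ContinuousLinearMap.coe_coe]
  unfold hessianAux at hH
  rw [hXx, hgs, h2] at hH
  change g.hessian f x v (G x) = mvfderiv I (g.gradSq f) x v - g.hessian f x v (G x) at hH
  change mvfderiv I (g.gradSq f) x v = 2 * g.hessian f x v (G x)
  linarith

/-- **`Hess f(grad f, grad f) = g⁻¹(d|∇f|², df) / 2`** (`mvfderiv_gradSq_apply` with `v = grad f`
and the symmetry of the Hessian). [cite: ONeill1983, Ch. 3, Lemma 3.49] -/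
theorem hessian_grad_grad_eq {f : M → ℝ} {x : M} (hf : CMDiffAt 2 f x) :
    g.hessian f x (g.sharp x (mvfderiv I f x).toLinearMap)
        (g.sharp x (mvfderiv I f x).toLinearMap) =
      g.innerDual x (mvfderiv I (g.gradSq f) x).toLinearMap (mvfderiv I f x).toLinearMap / 2 := by
  have h := g.mvfderiv_gradSq_apply hf (g.sharp x (mvfderiv I f x).toLinearMap)
  change g.hessian f x _ _ = mvfderiv I (g.gradSq f) x (g.sharp x (mvfderiv I f x).toLinearMap) / 2
  rw [h]
  ring

/-! ### Surfaces: the Laplacian in an orthonormal pair and the curvature of a level curve -/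

omit [CompleteSpace E] [I.Boundaryless] in
/-- **`Δf = Hess f(T, T) + Hess f(N, N)` in an orthonormal pair on a surface**: on a
`2`-dimensional manifold, for `T, N ∈ T_x M` with `g(T,T) = g(N,N) = 1`, `g(T,N) = 0`, the
Laplace–Beltrami operator `Δ_g f = tr_g Hess f` is `Hess f(T,T) + Hess f(N,N)` (an orthonormal pair
is an orthonormal basis; `trace_eq_sum_of_isOrthonormalFrame`). O'Neill 1983, Ch. 3, Def. 3.50 and
Lemma 3.52 ff. [cite: ONeill1983, Ch. 3, Def. 3.50] -/
theorem dalembertian_eq_hessian_add_of_orthonormal (h2 : finrank ℝ E = 2) (f : M → ℝ) {x : M}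
    {T N : TangentSpace I x} (hT : g.val x T T = 1) (hN : g.val x N N = 1)
    (hTN : g.val x T N = 0) :
    g.dalembertian f x = g.hessian f x T T + g.hessian f x N N := by
  classical
  set v : Fin 2 → TangentSpace I x := ![T, N] with hv
  have hv0 : v 0 = T := rfl
  have hv1 : v 1 = N := rfl
  have hNT : g.val x N T = 0 := by rw [g.symm x N T]; exact hTN
  have hli : LinearIndependent ℝ v := by
    rw [Fintype.linearIndependent_iff]
    intro c hc
    have hsum : ∑ i, c i • v i = c 0 • T + c 1 • N := by
      rw [Fin.sum_univ_two, hv0, hv1]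
    rw [hsum] at hc
    have h0 : g.val x (c 0 • T + c 1 • N) T = 0 := by rw [hc, map_zero]; rfl
    have h1 : g.val x (c 0 • T + c 1 • N) N = 0 := by rw [hc, map_zero]; rfl
    simp [hT, hTN, hNT, hN] at h0 h1
    intro i
    fin_cases i
    · exact h0
    · exact h1
  haveI : FiniteDimensional ℝ (TangentSpace I x) := ‹FiniteDimensional ℝ E›
  have hcard : Fintype.card (Fin 2) = finrank ℝ (TangentSpace I x) := by
    change Fintype.card (Fin 2) = finrank ℝ E
    rw [h2, Fintype.card_fin]
  set b := basisOfLinearIndependentOfCardEqFinrank hli hcard with hb_def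
  have hb : ∀ i, b i = v i := fun i ↦
    congrFun (coe_basisOfLinearIndependentOfCardEqFinrank hli hcard) i
  have hon : g.IsOrthonormalFrame x b := by
    refine ⟨fun i ↦ ?_, fun i j hij ↦ ?_⟩
    · fin_cases i
      · simpa [hb, hv0] using hT
      · simpa [hb, hv1] using hN
    · fin_cases i <;> fin_cases j
      · exact absurd rfl hij
      · simpa [hb, hv0, hv1] using hTN
      · simpa [hb, hv0, hv1] using hNT
      · exact absurd rfl hij
  rw [dalembertian, g.trace_eq_sum_of_isOrthonormalFrame b hon, Fin.sum_univ_two, hb, hb, hv0, hv1]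

/-- **The geodesic curvature of a level curve.** Let `(M, g)` be a surface (`dim = 2`) with `g`
positive definite at `γ t₀`, `f` of class `C²` at `γ t₀` with `|∇f|²(γ t₀) ≠ 0`, and `γ` a level
curve of `f` (`f ∘ γ` constant near `t₀`, `γ` differentiable near `t₀` with tangent lift
differentiable at `t₀`) of unit speed at `t₀`. With the unit normal `N = grad f / |∇f|` of the
level curve (pointing to increasing `f`),

  `⟨D_t γ'(t₀), N⟩ = ( g⁻¹(d|∇f|², df)/(2|∇f|²) − Δ_g f )(γ t₀) / |∇f|(γ t₀)`.

Proof: `⟨γ'', grad f⟩ = −Hess f(γ', γ')` (`val_covariantDerivAlong_velocity_grad_of_level`),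
`Hess f(γ', γ') = Δf − Hess f(N, N)` (`γ', N` orthonormal,
`dalembertian_eq_hessian_add_of_orthonormal`)
and `Hess f(N, N) = Hess f(grad f, grad f)/|∇f|² = g⁻¹(d|∇f|², df)/(2|∇f|²)`
(`hessian_grad_grad_eq`). Equivalently, the geodesic curvature of the level curve with respect to
the normal `−N` pointing into the sublevel set `{f ≤ f(γ t₀)}` is
`k = (Δf − Hess f(N,N))/|∇f| = div(grad f/|∇f|)`; for the round circle `f = |x|²` in the plane
this is `1/r`. This is the signed curvature `κ_N = ⟨D_t γ', N⟩_g` of Lee 2018, Ch. 9, p. 273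
(the boundary integrand of the Gauss–Bonnet formula, Thm. 9.3), computed for a level curve; the
intrinsic form of Schoen–Yau 1979, (2.27). [cite: Lee2018, Ch. 9, p. 273 and Thm. 9.3]
[cite: SchoenYauPMT1979, §2 (2.27)] -/
theorem val_covariantDerivAlong_velocity_unitNormal_of_level (h2 : finrank ℝ E = 2)
    {f : M → ℝ} {γ : ℝ → M} {t₀ : ℝ}
    (hpos : ∀ v : TangentSpace I (γ t₀), v ≠ 0 → 0 < g.val (γ t₀) v v)
    (hf : CMDiffAt 2 f (γ t₀)) (hγ : ∀ᶠ t in 𝓝 t₀, MDifferentiableAt 𝓘(ℝ, ℝ) I γ t)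
    (hγ2 : MDifferentiableAt 𝓘(ℝ, ℝ) I.tangent
      (fun t ↦ (TotalSpace.mk' E (γ t) (velocity I γ t) : TangentBundle I M)) t₀)
    (hlev : ∀ᶠ t in 𝓝 t₀, f (γ t) = f (γ t₀))
    (hunit : g.val (γ t₀) (velocity I γ t₀) (velocity I γ t₀) = 1)
    (hu : g.gradSq f (γ t₀) ≠ 0) :
    g.val (γ t₀) (covariantDerivAlong g.leviCivita γ (fun t ↦ velocity I γ t) t₀)
        ((Real.sqrt (g.gradSq f (γ t₀)))⁻¹ •
          g.sharp (γ t₀) (mvfderiv I f (γ t₀)).toLinearMap) =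
      (g.innerDual (γ t₀) (mvfderiv I (g.gradSq f) (γ t₀)).toLinearMap
            (mvfderiv I f (γ t₀)).toLinearMap / (2 * g.gradSq f (γ t₀))
          - g.dalembertian f (γ t₀)) / Real.sqrt (g.gradSq f (γ t₀)) := by
  -- notation
  set u : ℝ := g.gradSq f (γ t₀) with hu_def
  set G : TangentSpace I (γ t₀) := g.sharp (γ t₀) (mvfderiv I f (γ t₀)).toLinearMap with hG
  set T : TangentSpace I (γ t₀) := velocity I γ t₀ with hT
  set A : TangentSpace I (γ t₀) := covariantDerivAlong g.leviCivita γ (fun t ↦ velocity I γ t) t₀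
    with hA_def
  set P : ℝ := g.innerDual (γ t₀) (mvfderiv I (g.gradSq f) (γ t₀)).toLinearMap
    (mvfderiv I f (γ t₀)).toLinearMap with hP
  -- `u = ⟨G, G⟩ > 0`
  have huG : u = g.val (γ t₀) G G := innerDual_eq_val_sharp_sharp g (γ t₀) _ _
  have hu0 : 0 < u := by
    by_cases hG0 : G = 0
    · exact absurd (by rw [huG, hG0, map_zero]) hu
    · rw [huG]; exact hpos G hG0
  set s : ℝ := Real.sqrt u with hs_def
  have hs : 0 < s := Real.sqrt_pos.2 hu0
  have hs2 : s ^ 2 = u := Real.sq_sqrt hu0.le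
  have hsne : s ≠ 0 := hs.ne'
  -- first-order and second-order level identities
  have hγc : ContinuousAt γ t₀ := (mdifferentiableAt_of_mdifferentiableAt_lift hγ2).continuousAt
  have hdfT : mvfderiv I f (γ t₀) T = 0 := mvfderiv_velocity_eq_zero_of_level hf hγ hγc hlev
  have hAG : g.val (γ t₀) A G = -g.hessian f (γ t₀) T T :=
    g.val_covariantDerivAlong_velocity_grad_of_level hf hγ hγ2 hlev
  -- the orthonormal pair `T`, `N = s⁻¹ G`
  have hGT : g.val (γ t₀) G T = 0 := by
    simp only [hG, val_sharp_apply, ContinuousLinearMap.coe_coe]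
    exact hdfT
  have hTG : g.val (γ t₀) T G = 0 := by rw [g.symm (γ t₀) T G]; exact hGT
  have hNN : g.val (γ t₀) (s⁻¹ • G) (s⁻¹ • G) = 1 := by
    simp only [map_smul, FunLike.coe_smul, Pi.smul_apply, smul_eq_mul, ← huG]
    field_simp
    rw [hs2]
  have hTN : g.val (γ t₀) T (s⁻¹ • G) = 0 := by
    simp only [map_smul, smul_eq_mul, hTG, mul_zero]
  -- Laplacian split and the normal Hessian
  have hΔ := g.dalembertian_eq_hessian_add_of_orthonormal h2 f hunit hNN hTN
  have hHNN : g.hessian f (γ t₀) (s⁻¹ • G) (s⁻¹ • G) = (s⁻¹) ^ 2 * g.hessian f (γ t₀) G G := by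
    simp only [map_smul, LinearMap.smul_apply, smul_eq_mul]
    ring
  have hHGG : g.hessian f (γ t₀) G G = P / 2 := g.hessian_grad_grad_eq hf
  -- the left-hand side
  have hL : g.val (γ t₀) A (s⁻¹ • G) = s⁻¹ * g.val (γ t₀) A G := by
    simp only [map_smul, smul_eq_mul]
  rw [hL, hAG]
  -- assemble
  have hTT : g.hessian f (γ t₀) T T = g.dalembertian f (γ t₀) - (s⁻¹) ^ 2 * (P / 2) := by
    rw [hΔ, hHNN, hHGG]; ring
  rw [hTT]
  field_simp
  rw [hs2]
  ring

/-! ### The curvature flux integrand for a cut-off of a function -/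

omit [CompleteSpace E] [I.Boundaryless] in
/-- **The curvature flux integrand of a cut-off `ψ = η ∘ f`.** For `f : M → ℝ` differentiable at
`x` with `|∇f|²(x) ≠ 0` and `η : ℝ → ℝ` differentiable at `f x`, the integrand of the flux formula
for the curvature of a surface (`SurfaceCurvatureFlux.lean`:
`∫ ψ S dμ = −∫ (g⁻¹(d|∇f|², dψ) − 2 Δf g⁻¹(df, dψ)) / |∇f|² dμ`) is, for `ψ = η ∘ f`,

  `(g⁻¹(d|∇f|², dψ) − 2 Δf g⁻¹(df, dψ)) / |∇f|² = 2 η'(f x) ( g⁻¹(d|∇f|², df)/(2|∇f|²) − Δf )`,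

i.e. `2 η'(f) |∇f| ⟨γ'', N⟩` for the unit-speed level curve through `x`
(`val_covariantDerivAlong_velocity_unitNormal_of_level`): the geodesic curvature of the level
curves against the density `−2η'(f)|∇f|`, the smeared Gauss–Bonnet boundary term of the sublevel
sets of `f` (Lee 2018, Ch. 9, Thm. 9.3; Schoen–Yau 1979, (2.26)).
[cite: Lee2018, Ch. 9, Thm. 9.3] -/
theorem flux_integrand_comp_eq (f : M → ℝ) {η : ℝ → ℝ} {x : M}
    (hη : DifferentiableAt ℝ η (f x)) (hfx : MDifferentiableAt I 𝓘(ℝ, ℝ) f x)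
    (hu : g.gradSq f x ≠ 0) :
    (g.innerDual x (mvfderiv I (g.gradSq f) x).toLinearMap (mvfderiv I (η ∘ f) x).toLinearMap
        - 2 * g.dalembertian f x *
          g.innerDual x (mvfderiv I f x).toLinearMap (mvfderiv I (η ∘ f) x).toLinearMap) /
        g.gradSq f x =
      2 * deriv η (f x) *
        (g.innerDual x (mvfderiv I (g.gradSq f) x).toLinearMap (mvfderiv I f x).toLinearMap /
            (2 * g.gradSq f x) - g.dalembertian f x) := by
  have hchain' : ((mvfderiv I (η ∘ f) x).toLinearMap : Module.Dual ℝ (TangentSpace I x)) =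
      deriv η (f x) • (mvfderiv I f x).toLinearMap := by
    apply LinearMap.ext
    intro v
    simp only [ContinuousLinearMap.coe_coe, LinearMap.smul_apply, smul_eq_mul]
    exact mvfderiv_real_comp hη hfx v
  have hsm : ∀ (α β : Module.Dual ℝ (TangentSpace I x)) (c : ℝ),
      g.innerDual x α (c • β) = c * g.innerDual x α β := fun α β c ↦ by
    simp only [innerDual, map_smul, smul_eq_mul]
  rw [hchain', hsm, hsm]
  have hgs : g.innerDual x (mvfderiv I f x).toLinearMap (mvfderiv I f x).toLinearMap =
      g.gradSq f x := rfl
  rw [hgs]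
  field_simp

end PseudoRiemannianMetric

end Literature.Geometry.Lorentzian

end
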